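import Mathlib
import HarnessLib.Audit
import Summits.PneNP.PneNP.Theorems.PstarGateBridge

/-!
# One GATED chord, CASE T on bridge data: chamber incompatibility and the enlarged forcing set (ROUND-25, O2 / E2 step (a′); prover-1 g18)

FRONTIER range-avoidance ladder, rung F-N3 (`stmt-PneNP-19007`), cell `pnp-ideate` (planner memo `r24/CORE-BOUND-NOTES.md` §14.34–14.35; this seat's
`HOME/pnp-ideate-prover-1/g18/E2-PLAN.md` §4); restricted-model proof complexity — nothing here bears on `P` versus `NP`.

CASE T of `PstarGateBridge.regime_trichotomy`: the other chords read along `m ∈ {(0,1), (1,1)}`, transverse to the gate's `(1,0)`.  After the clean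
chain's basis change `toX m` (`PstarChordSystemMap`; `m ↦ (1,0)`, and `(1,0) ↦ (0,1)`) the other chords read ONLY the first coordinate and the gated chord
ONLY the second (mirror image `TransverseSnd` of `PstarGateRegime.TransverseAt`), and the basis-changed "second constraint" is `q_m = qDir I B m`.  Results:

* model mirrors: `val_snd_of_transverseSnd`, `unreach_fst_of_reachSnd`, `reachSnd_iff` (`ReachSnd` at `a` iff `u_e(a) = 0 ∧ ℓ(a) = 1`, or
  `q(a) + u_e(a)·ℓ(a) = 0`), `forced_of_reachSnd`;
* `caseT_not_cokillable` — **(T1)-input**: in CASE T, inside the gate chamber `{ℓ ≠ 0}` the gated chord `e` and any other chord `e'` have no common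
  zero of `u_e, u_{e'}` (`PstarGateDirection.parallel_of_cokillable`);
* `caseT_forced` — **the ENLARGED forcing set**: for every base point `x` with `(u_e(x) = 0 ∧ ℓ(x) ≠ 0) ∨ q_m(x) + u_e(x)·ℓ(x) = 0` — i.e. on
  `Z(q_m + ℓ) ∪ ({ℓ = 1} ∩ Z(u_e))` — EVERY other chord is ON: `Q_{D e'}(x) = γ_{e'} + 1`; no chord-minimality is used;
* `caseT_fst` — and there the first basis-changed coordinate of "state-free part + forced reads" equals its target plus one (the memo's `F₂ ≡ κ`).
-/

set_option linter.dupNamespace false -- `Summit.PneNP.PneNP.…`: summit = sub-problem name (D-0017 single-conjunct layout)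

open Finset Literature.Computability.Complexity
open Summit.PneNP.PneNP.Theorems.PstarTyped (Typed)
open Summit.PneNP.PneNP.Theorems.PstarSALevel (varSet bdry BoundaryExpanding SimpleOverlap)
open Summit.PneNP.PneNP.Theorems.PstarProductRank (qform)
open Summit.PneNP.PneNP.Theorems.PstarReadSumset (V2)
open Summit.PneNP.PneNP.Theorems.PstarChordSystem (ChordSystem)
open Summit.PneNP.PneNP.Theorems.PstarChordSystemMap (mapSys toX mapSys_u mapSys_ρ mapSys_ρ' mapSys_F mapSys_t mapSys_val mapSys_adm toX_injective
  infeasible_mapSys)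
open Summit.PneNP.PneNP.Theorems.PstarChordBridgeTools (privs coef)
open Summit.PneNP.PneNP.Theorems.PstarChordBridge (BridgeData sys sys_ρ_of_not_mem Solution Lift infeasible_of_not_solution)
open Summit.PneNP.PneNP.Theorems.PstarChordBridgeForcing (gam sys_u_eq)
open Summit.PneNP.PneNP.Theorems.PstarChordBridgeBasis (qDir q_dir)
open Summit.PneNP.PneNP.Theorems.PstarGateDirection (forced_of_reach_snd parallel_of_cokillable)
open Summit.PneNP.PneNP.Theorems.PstarGateRegime (unread_of_unreach_fst fst_eq_of_unreach_fst)
open Summit.PneNP.PneNP.Theorems.PstarGateBridge (GateHyp gate_reads)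

namespace Summit.PneNP.PneNP.Theorems.PstarGateCaseT

/-- Every element of `𝔽₂` is `0` or `1`. -/
private theorem zmod2_cases (t : ZMod 2) : t = 0 ∨ t = 1 := by
  revert t; decide

/-! ## Model mirrors: the gate reads the SECOND coordinate -/

section Model

variable {ι A : Type*} [DecidableEq ι] (S : ChordSystem ι A)

/-- **Transverse gate data at `a`, mirror form**: the chords other than `e` read only the FIRST coordinate; the gated chord `e` reads only the second,
only through its first private (the shape after `toX m` in CASE T). -/
def TransverseSnd (E : Finset ι) (e : ι) (a : A) : Prop :=
  (∀ i ∈ E, i ≠ e → (S.ρ i a).2 = 0 ∧ (S.ρ' i a).2 = 0) ∧ S.ρ' e a = 0 ∧ (S.ρ e a).1 = 0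

/-- The second coordinate is REACHABLE at `a`. -/
def ReachSnd (E : Finset ι) (a : A) : Prop := ∃ s, S.Adm E a s ∧ (S.val E a s).2 = S.t.2

/-- The second coordinate of the value sees the gate's state only: `(F a).2 + s_e.1 · (ρ_e a).2`. -/
theorem val_snd_of_transverseSnd {E : Finset ι} {e : ι} (he : e ∈ E) {a : A} (hT : TransverseSnd S E e a) (s : ι → ZMod 2 × ZMod 2) :
    (S.val E a s).2 = (S.F a).2 + (s e).1 * (S.ρ e a).2 := by
  obtain ⟨hoth, hρ', -⟩ := hT
  rw [S.val_eq he]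
  unfold ChordSystem.val ChordSystem.contrib
  rw [Prod.snd_add, Prod.snd_add, Prod.snd_add, Prod.snd_sum, Prod.smul_snd, Prod.smul_snd, hρ', Prod.snd_zero, smul_zero, add_zero,
    smul_eq_mul]
  have h0 : ∑ i ∈ E.erase e, ((s i).1 • S.ρ i a + (s i).2 • S.ρ' i a).2 = 0 := sum_eq_zero fun i hi => by
    obtain ⟨hie, hiE⟩ := mem_erase.1 hi
    rw [Prod.snd_add, Prod.smul_snd, Prod.smul_snd, (hoth i hiE hie).1, (hoth i hiE hie).2, smul_zero, smul_zero, add_zero]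
  rw [h0, add_zero, add_comm]

/-- **Reachable second coordinate ⟹ unreachable first coordinate** (transplant the gate's state). -/
theorem unreach_fst_of_reachSnd {E : Finset ι} (hI : S.Infeasible E) {e : ι} (he : e ∈ E) {a : A} (hT : TransverseSnd S E e a)
    (hreach : ReachSnd S E a) : ∀ s, S.Adm E a s → (S.val E a s).1 ≠ S.t.1 := by
  intro s hadm h1
  obtain ⟨s', hadm', h2'⟩ := hreach
  refine hI a (Function.update s e (s' e)) (S.adm_update (S.adm_erase hadm e) (hadm' e he)) (Prod.ext ?_ ?_)
  · have key : ∀ s₁ : ι → ZMod 2 × ZMod 2, (S.val E a s₁).1 = (S.F a).1 + (S.val (E.erase e) a s₁).1 - (S.F a).1 := by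
      intro s₁
      rw [S.val_eq he, Prod.fst_add]
      unfold ChordSystem.contrib
      rw [Prod.fst_add, Prod.smul_fst, Prod.smul_fst, hT.2.1, hT.2.2, Prod.fst_zero, smul_zero, smul_zero, add_zero, zero_add]
      ring
    rw [key, S.val_erase_update, ← key]
    exact h1
  · rw [val_snd_of_transverseSnd S he hT, Function.update_self, ← val_snd_of_transverseSnd S he hT s']
    exact h2'

/-- **The reachability set in closed form** (mirror of `PstarGateRegime.reachFst_iff`). -/
theorem reachSnd_iff {E : Finset ι} {e : ι} (he : e ∈ E) {a : A} (hT : TransverseSnd S E e a) :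
    ReachSnd S E a ↔ (S.u e a = 0 ∧ (S.ρ e a).2 = 1) ∨ (S.F a).2 + S.u e a * (S.ρ e a).2 = S.t.2 := by
  constructor
  · rintro ⟨s, hadm, h2⟩
    rw [val_snd_of_transverseSnd S he hT] at h2
    have hse := hadm e he
    rcases zmod2_cases (S.u e a) with hu | hu
    · rcases zmod2_cases ((s e).1) with h0 | h0
      · right; rw [hu, zero_mul, add_zero]; rw [h0, zero_mul, add_zero] at h2; exact h2
      · rcases zmod2_cases ((S.ρ e a).2) with hr | hr
        · right; rw [hu, zero_mul, add_zero]; rw [hr, mul_zero, add_zero] at h2; exact h2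
        · exact Or.inl ⟨hu, hr⟩
    · right
      have hs1 : (s e).1 = 1 := by
        rcases zmod2_cases ((s e).1) with h0 | h0
        · rw [h0, zero_mul] at hse; rw [← hse] at hu; exact absurd hu (by decide)
        · exact h0
      rw [hu, one_mul]; rw [hs1, one_mul] at h2; exact h2
  · rintro (⟨hu, hr⟩ | h)
    · let s : ι → ZMod 2 × ZMod 2 := fun i => if i = e then (S.t.2 + (S.F a).2, 0) else (S.u i a, 1)
      refine ⟨s, fun i hi => ?_, ?_⟩
      · by_cases hie : i = e
        · subst hie; simp [s, hu]
        · simp [s, hie]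
      · rw [val_snd_of_transverseSnd S he hT]
        simp only [s, if_true, hr, mul_one]
        have e2 : ∀ f t : ZMod 2, f + (t + f) = t := by decide
        exact e2 _ _
    · let s : ι → ZMod 2 × ZMod 2 := fun i => (S.u i a, 1)
      refine ⟨s, fun i _ => by simp [s], ?_⟩
      rw [val_snd_of_transverseSnd S he hT]
      exact h

/-- **Forced form**: where the second coordinate is reachable, every other chord read there is ON. -/
theorem forced_of_reachSnd {E : Finset ι} (hI : S.Infeasible E) {e : ι} {a : A} (hT : TransverseSnd S E e a) (hreach : ReachSnd S E a)
    {i : ι} (hi : i ∈ E) (hie : i ≠ e) (hR : S.Read i a) : S.u i a = 1 :=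
  forced_of_reach_snd S hI hi hreach (hT.1 i hi hie) hR

end Model

/-! ## Instance layer: CASE T on bridge data -/

variable {n m : ℕ}

/-- `toX mv` sends `mv ≠ 0` to `(1,0)`. -/
theorem toX_self {mv : V2} (hmv : mv ≠ 0) : toX mv mv = (1, 0) := by
  obtain ⟨a, b⟩ := mv
  revert hmv a b
  decide

/-- In CASE T, `toX mv` sends the gate's direction `(1,0)` to `(0,1)`. -/
theorem toX_gate {mv : V2} (hT : mv = (0, 1) ∨ mv = (1, 1)) : toX mv (1, 0) = (0, 1) := by
  rcases hT with rfl | rfl <;> decide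

/-- **(T1)-input: chamber incompatibility in CASE T.**  Other chord `e'` read along `mv ∈ {(0,1),(1,1)}` at `x`; the gate's coefficient `ℓ(x) ≠ 0`;
model infeasible.  Then `u_e(x) = 0 ⟹ u_{e'}(x) ≠ 0`: `{ℓ = 1} ∩ Z(u_e) ∩ Z(u_{e'}) = ∅`. -/
theorem caseT_not_cokillable (I : LocalMap 4 n m) (hI : I.IsPure xorAndPred) (hT : Typed I) {B : BridgeData n m} (hW : B.WF I) (hL : Lift I B)
    {e : Fin m} (hG : GateHyp I B e) (hT3 : ¬ ∃ z, Solution I B B.J₀ z) {mv : V2} (hmvT : mv = (0, 1) ∨ mv = (1, 1))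
    {e' : Fin m} (he' : e' ∈ B.N) (hne : e' ≠ e) {x : Fin n → ZMod 2}
    (hP : ((sys I B).ρ e' x = 0 ∨ (sys I B).ρ e' x = mv) ∧ ((sys I B).ρ' e' x = 0 ∨ (sys I B).ρ' e' x = mv))
    (hread : (sys I B).ρ e' x ≠ 0 ∨ (sys I B).ρ' e' x ≠ 0) (hl : coef I B.C₁ B.G₁ (I.vars e 2) x ≠ 0)
    (hue : (sys I B).u e x = 0) : (sys I B).u e' x ≠ 0 := by
  intro hue'
  have hinf : (sys I B).Infeasible B.N := infeasible_of_not_solution I hI hT hW hL hT3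
  have hl1 : coef I B.C₁ B.G₁ (I.vars e 2) x = 1 := (zmod2_cases _).resolve_left hl
  have hρ : (sys I B).ρ e x = (1, 0) := by rw [(gate_reads I hI hG x).1, hl1]
  have h10 : ((1, 0) : V2) ≠ 0 := by decide
  have hmv10 : mv ≠ (1, 0) := by rcases hmvT with rfl | rfl <;> decide
  -- a non-zero read `y = mv` of `e'`
  obtain ⟨y, hy, hy0, hymv⟩ : ∃ y : V2, (y = (sys I B).ρ e' x ∨ y = (sys I B).ρ' e' x) ∧ y ≠ 0 ∧ y = mv := by
    rcases hread with h | h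
    · exact ⟨_, Or.inl rfl, h, hP.1.resolve_left h⟩
    · exact ⟨_, Or.inr rfl, h, hP.2.resolve_left h⟩
  have := parallel_of_cokillable (sys I B) hinf hG.1 he' (Ne.symm hne) hρ h10 hy hy0 hue hue'
  exact hmv10 (hymv ▸ this)

/-- The basis-changed model in CASE T is transverse in the mirror sense, everywhere. -/
theorem transverseSnd_toX (I : LocalMap 4 n m) (hI : I.IsPure xorAndPred) {B : BridgeData n m} {e : Fin m} (hG : GateHyp I B e) {mv : V2}
    (hmvT : mv = (0, 1) ∨ mv = (1, 1))
    (hP : ∀ e' ∈ B.N, e' ≠ e → ∀ a, ((sys I B).ρ e' a = 0 ∨ (sys I B).ρ e' a = mv) ∧ ((sys I B).ρ' e' a = 0 ∨ (sys I B).ρ' e' a = mv))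
    (a : Fin n → ZMod 2) : TransverseSnd (mapSys (sys I B) (toX mv)) B.N e a := by
  have hmv : mv ≠ 0 := by rcases hmvT with rfl | rfl <;> decide
  refine ⟨fun i hi hie => ?_, ?_, ?_⟩
  · rw [mapSys_ρ, mapSys_ρ']
    obtain ⟨h1, h2⟩ := hP i hi hie a
    refine ⟨?_, ?_⟩
    · rcases h1 with h | h
      · rw [h, map_zero]; rfl
      · rw [h, toX_self hmv]
    · rcases h2 with h | h
      · rw [h, map_zero]; rfl
      · rw [h, toX_self hmv]
  · rw [mapSys_ρ', (gate_reads I hI hG a).2, map_zero]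
  · rw [mapSys_ρ, (gate_reads I hI hG a).1]
    rcases zmod2_cases (coef I B.C₁ B.G₁ (I.vars e 2) a) with h | h
    · rw [h]; rw [show ((0 : ZMod 2), (0 : ZMod 2)) = (0 : V2) from rfl, map_zero]; rfl
    · rw [h, toX_gate hmvT]

/-- The gate's second-coordinate read after `toX mv` is its coefficient `ℓ`. -/
theorem toX_gate_read (I : LocalMap 4 n m) (hI : I.IsPure xorAndPred) {B : BridgeData n m} {e : Fin m} (hG : GateHyp I B e) {mv : V2}
    (hmvT : mv = (0, 1) ∨ mv = (1, 1)) (a : Fin n → ZMod 2) :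
    ((mapSys (sys I B) (toX mv)).ρ e a).2 = coef I B.C₁ B.G₁ (I.vars e 2) a := by
  rw [mapSys_ρ, (gate_reads I hI hG a).1]
  rcases zmod2_cases (coef I B.C₁ B.G₁ (I.vars e 2) a) with h | h
  · rw [h]; rw [show ((0 : ZMod 2), (0 : ZMod 2)) = (0 : V2) from rfl, map_zero]; rfl
  · rw [h, toX_gate hmvT]

/-- **CASE T: the enlarged forcing set.**  Other chords read along `mv ∈ {(0,1),(1,1)}` and are read; model infeasible.  For every `x` with
`(u_e(x) = 0 ∧ ℓ(x) = 1) ∨ q_{mv}(x) + u_e(x)·ℓ(x) = 0`, every other chord is ON: `Q_{D e'}(x) = γ_{e'} + 1`. -/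
theorem caseT_forced (I : LocalMap 4 n m) (hI : I.IsPure xorAndPred) (hT : Typed I) {B : BridgeData n m} (hW : B.WF I) (hL : Lift I B)
    {e : Fin m} (hG : GateHyp I B e) (hT3 : ¬ ∃ z, Solution I B B.J₀ z) {mv : V2} (hmvT : mv = (0, 1) ∨ mv = (1, 1))
    (hP : ∀ e' ∈ B.N, e' ≠ e → ∀ a, ((sys I B).ρ e' a = 0 ∨ (sys I B).ρ e' a = mv) ∧ ((sys I B).ρ' e' a = 0 ∨ (sys I B).ρ' e' a = mv))
    (hread : ∀ e' ∈ B.N, e' ≠ e → ∀ a, (sys I B).ρ e' a ≠ 0 ∨ (sys I B).ρ' e' a ≠ 0) {x : Fin n → ZMod 2}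
    (hx : ((sys I B).u e x = 0 ∧ coef I B.C₁ B.G₁ (I.vars e 2) x = 1) ∨ qDir I B mv x + (sys I B).u e x * coef I B.C₁ B.G₁ (I.vars e 2) x = 0) :
    ∀ e' ∈ B.N, e' ≠ e → qform (B.D e') (fun j => I.vars j 2) (fun j => I.vars j 3) x = gam B e' + 1 := by
  intro e' he' hne
  have hmv : mv ≠ 0 := by rcases hmvT with rfl | rfl <;> decide
  set S' := mapSys (sys I B) (toX mv) with hS'
  have hinf' : S'.Infeasible B.N := infeasible_mapSys _ (toX_injective hmv) (infeasible_of_not_solution I hI hT hW hL hT3)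
  have hTr : TransverseSnd S' B.N e x := transverseSnd_toX I hI hG hmvT hP x
  -- reachability of the second coordinate at `x`
  have hreach : ReachSnd S' B.N x := by
    rw [reachSnd_iff S' hG.1 hTr, hS', toX_gate_read I hI hG hmvT, mapSys_u]
    rcases hx with h | h
    · exact Or.inl h
    · right
      have hq := q_dir I B mv x
      have e3 : ∀ F t q ul : ZMod 2, F + t = q → q + ul = 0 → F + ul = t := by decide
      exact e3 _ _ _ _ hq h
  have hR' : S'.Read e' x := by
    unfold ChordSystem.Read
    rw [hS', mapSys_ρ, mapSys_ρ']
    rcases hread e' he' hne x with h | h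
    · exact Or.inl fun h0 => h (toX_injective hmv (by rw [h0, map_zero]))
    · exact Or.inr fun h0 => h (toX_injective hmv (by rw [h0, map_zero]))
  have hu := forced_of_reachSnd S' hinf' hTr hreach he' hne hR'
  rw [hS', mapSys_u, sys_u_eq] at hu
  have e1 : ∀ g Q : ZMod 2, g + Q = 1 → Q = g + 1 := by decide
  exact e1 _ _ hu

/-- **CASE T, the first basis-changed coordinate**: on the same set, the first coordinate of the state-free part plus the reads of the chords that are ON
misses its target by one (`fst_eq_of_unreach_fst` for the basis-changed model) — the memo's "`F₂ ≡ κ` on `Ω`" in `toX` coordinates. -/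
theorem caseT_fst (I : LocalMap 4 n m) (hI : I.IsPure xorAndPred) (hT : Typed I) {B : BridgeData n m} (hW : B.WF I) (hL : Lift I B)
    {e : Fin m} (hG : GateHyp I B e) (hT3 : ¬ ∃ z, Solution I B B.J₀ z) {mv : V2} (hmvT : mv = (0, 1) ∨ mv = (1, 1))
    (hP : ∀ e' ∈ B.N, e' ≠ e → ∀ a, ((sys I B).ρ e' a = 0 ∨ (sys I B).ρ e' a = mv) ∧ ((sys I B).ρ' e' a = 0 ∨ (sys I B).ρ' e' a = mv))
    {x : Fin n → ZMod 2}
    (hx : ((sys I B).u e x = 0 ∧ coef I B.C₁ B.G₁ (I.vars e 2) x = 1) ∨ qDir I B mv x + (sys I B).u e x * coef I B.C₁ B.G₁ (I.vars e 2) x = 0) :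
    ((mapSys (sys I B) (toX mv)).F x).1 +
        ∑ i ∈ B.N.filter (fun i => ¬ (sys I B).u i x = 0), ((mapSys (sys I B) (toX mv)).ρ i x + (mapSys (sys I B) (toX mv)).ρ' i x).1 =
      (mapSys (sys I B) (toX mv)).t.1 + 1 := by
  have hmv : mv ≠ 0 := by rcases hmvT with rfl | rfl <;> decide
  set S' := mapSys (sys I B) (toX mv) with hS'
  have hinf' : S'.Infeasible B.N := infeasible_mapSys _ (toX_injective hmv) (infeasible_of_not_solution I hI hT hW hL hT3)
  have hTr : TransverseSnd S' B.N e x := transverseSnd_toX I hI hG hmvT hP x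
  have hreach : ReachSnd S' B.N x := by
    rw [reachSnd_iff S' hG.1 hTr, hS', toX_gate_read I hI hG hmvT, mapSys_u]
    rcases hx with h | h
    · exact Or.inl h
    · right
      have hq := q_dir I B mv x
      have e3 : ∀ F t q ul : ZMod 2, F + t = q → q + ul = 0 → F + ul = t := by decide
      exact e3 _ _ _ _ hq h
  have h := fst_eq_of_unreach_fst S' (unreach_fst_of_reachSnd S' hinf' hG.1 hTr hreach)
  rw [hS', mapSys_u] at h
  exact h

end Summit.PneNP.PneNP.Theorems.PstarGateCaseT
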